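import Mathlib
import Summits.AtomisticToContinuum.Crystallization.Theses.LaminarSixThreeThree

/-!
# `LaminarToBarlow` — the glue of the laminar layer (route LaminarSixThreeThree)

Item stmt-AtomisticToContinuum-14298:
`LjLaminarity → LaminarSaturation → LaminarRigidity → LaminarBarlowWindows`.

Proof (pure logic over the three cruxes). Fix `R > 0`, `ε ∈ (0, 1/4)` and a sequence of
Lennard-Jones ground states `x`. Take the constant function `C` of `LaminarRigidity` and put
`R' = max (4R) 16`, `ε' = min (ε / max (C R') 1) (1/1000)`. `LaminarSaturation` (fed with
`LjLaminarity`) at `(R', ε')` says that the fraction of particles without a GOOD `(R', ε')`-window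
tends to `0`; `LaminarRigidity` at `(R', ε')` turns a GOOD window into a two-way
`C R' * ε'`-matching with a Barlow stacking on radius `R' / 4 ≥ R`, and `C R' * ε' ≤ ε`.
Two-way matching is monotone in the radius and in the tolerance, so the bad set of
`LaminarBarlowWindows` is contained in the bad set of `LaminarSaturation` for every `N`;
the `Tendsto` passes by comparison of `Nat.card` of the two subtypes and `squeeze_zero`.
-/

namespace Summit.AtomisticToContinuum.Crystallization.Theorems

open Summit.AtomisticToContinuum.Crystallization.Theses.LaminarSixThreeThree

/-- Arithmetic of the tolerances: with `ε' = min (ε / max c 1) (1/1000)` and `0 < ε` one has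
`0 < ε'`, `ε' ≤ 1/1000` and `c * ε' ≤ ε` (whatever the sign of `c`). -/
theorem laminarToBarlow_tolerance (c ε : ℝ) (hε : 0 < ε) :
    0 < min (ε / max c 1) (1 / 1000) ∧ min (ε / max c 1) (1 / 1000) ≤ 1 / 1000 ∧
      c * min (ε / max c 1) (1 / 1000) ≤ ε := by
  have hM : (1 : ℝ) ≤ max c 1 := le_max_right _ _
  have hMpos : (0 : ℝ) < max c 1 := lt_of_lt_of_le one_pos hM
  have hpos : 0 < min (ε / max c 1) (1 / 1000) := lt_min (div_pos hε hMpos) (by norm_num)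
  refine ⟨hpos, min_le_right _ _, ?_⟩
  have h1 : min (ε / max c 1) (1 / 1000) ≤ ε / max c 1 := min_le_left _ _
  have h2 : c ≤ max c 1 := le_max_left _ _
  calc c * min (ε / max c 1) (1 / 1000)
      ≤ max c 1 * min (ε / max c 1) (1 / 1000) :=
        mul_le_mul_of_nonneg_right h2 hpos.le
    _ ≤ max c 1 * (ε / max c 1) := mul_le_mul_of_nonneg_left h1 hMpos.le
    _ = ε := by field_simp

/-- **Glue of the laminar layer** (item stmt-AtomisticToContinuum-14298 of route
LaminarSixThreeThree): `LjLaminarity → LaminarSaturation → LaminarRigidity → LaminarBarlowWindows`.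
Given `R, ε`, saturation is applied at `R' = max (4R) 16`, `ε' = min (ε / max (C R') 1) (1/1000)`
and then rigidity; the two-way matching is monotone in radius and tolerance, so the bad set only
shrinks and the `Tendsto` passes by `squeeze_zero`. -/
theorem laminarToBarlow_proof : LaminarToBarlow := by
  unfold LaminarToBarlow
  intro hLam hSat hRig
  unfold LaminarBarlowWindows
  intro R ε hR hε _hε4 x hx
  obtain ⟨C, hC⟩ := hRig
  -- the radius and tolerance at which saturation and rigidity are invoked
  set R' : ℝ := max (4 * R) 16
  have hR'16 : (16 : ℝ) ≤ R' := le_max_right _ _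
  have hR'2 : (2 : ℝ) ≤ R' := le_trans (by norm_num) hR'16
  have hRR' : R ≤ R' / 4 := by
    have h4 : 4 * R ≤ R' := le_max_left _ _
    linarith
  obtain ⟨hε'pos, hε'le, hCε'⟩ := laminarToBarlow_tolerance (C R') ε hε
  set ε' : ℝ := min (ε / max (C R') 1) (1 / 1000)
  -- saturation: the fraction of particles without a GOOD (R', ε')-window tends to zero
  have hT := hSat hLam R' ε' hR'2 hε'pos x hx
  refine squeeze_zero (fun N => ?_) (fun N => ?_) hT
  · positivity
  · refine div_le_div_of_nonneg_right (Nat.cast_le.mpr ?_) (Nat.cast_nonneg N)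
    -- the bad set of `LaminarBarlowWindows` lies inside the bad set of `LaminarSaturation`
    refine Nat.card_le_card_of_injective
      (Subtype.map id fun i hi hgood => hi ?_) (Subtype.map_injective _ Function.injective_id)
    -- rigidity: a GOOD (R', ε')-window is C R' * ε'-matched to a Barlow stacking on radius R' / 4
    obtain ⟨a, h, ha1, ha2, hh1, hh2, s, hs, z, hz, A, hA1, hA2⟩ :=
      hC R' ε' hR'16 hε'pos hε'le N (x N) i hgood
    refine ⟨a, h, ha1, ha2, hh1, hh2, s, hs, z, hz, A, ?_, ?_⟩
    · intro p hp hpz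
      obtain ⟨j, hj⟩ := hA1 p hp (hpz.trans hRR')
      exact ⟨j, hj.trans hCε'⟩
    · intro j hj
      obtain ⟨p, hp, hpj⟩ := hA2 j (hj.trans hRR')
      exact ⟨p, hp, hpj.trans hCε'⟩

end Summit.AtomisticToContinuum.Crystallization.Theorems
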